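import Summits.NavierStokesRegularity.FluidComputer.LocalisationFace
import Literature.Analysis.FluidPDE.BesovBlowupConcentration
import Literature.Analysis.FluidPDE.CKNLocalRegularityRRSPressure
import Literature.Analysis.FluidPDE.NSViscosityRescaling
import Literature.Analysis.FluidPDE.NSLerayHopfABCScaling
import HarnessLib

/-!
# Fluid computer — the level dictionary, CKN FACE (L34): ε of scale-invariant space–time mass at EVERY scale
# around the singular point

HONEST FRAMING (cell `pub-fluidc`, verbatim): *low prior, high value-of-information experiment on Tao's
machine paradigm; NOT a claim that NS blows up.* Theorem side of the cell; nothing here is evidence of blow-up.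
`LocalisationFace` (L33′) gives every maximal smooth Leray–Hopf solution a SINGULAR POINT `x₀` at its lifespan.
The Caffarelli–Kohn–Nirenberg ε-regularity theory of the tree (Robinson–Rodrigo–Sadowski 2016 Thm. 15.3, PROVED:
`RRS2016.theorem15_3_holds`; its final-time-apex form `eLpNorm_top_lt_top_of_cknC_add_cknD_lt`, Wang–Zhang 2017 §4
Step 1) then says what "singular" costs in the scale-invariant space–time currency. In the viscosity-normalised
variables `w(s, x) = ν⁻¹ u(s/ν, x)`, `π(s, x) = ν⁻² p(s/ν, x)` (lifespan `νT`, viscosity `1`;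
`FluidPDE.timeRescale`), with the Riesz-normalised pressure gauge `q(s, ·) = π(s, ·) − (π(s, 0) − ϖ[w(s)](0))`:

* `ckn_concentration` (**L34 — THE CKN FACE**): there is ONE absolute `ε > 0` such that for every `ν > 0`,
  `T > 0` and every maximal smooth solution `(u, p)` of the unforced Navier–Stokes system on `ℝ³ × [0, T)` which is
  Leray–Hopf from `u 0`, there is a point `x₀` with
  `ε ≤ C(ρ) + D(ρ) := ρ⁻² ∫∫_{Q_ρ(νT, x₀)} (|w|³ + |q|^{3/2})` for EVERY `0 < ρ < √(νT)`
  (`cknC`, `cknD` over the backward parabolic cylinders `Q_ρ = (νT − ρ², νT) × B_ρ(x₀)`).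

Reading in the original variables (a change of variables, not formalised here): `C(ρ) + D(ρ) =
(νρ)⁻² ∫_{T−ρ²/ν}^{T} ∫_{B_ρ(x₀)} (|u|³ + |p̃|^{3/2}) dx dt` with `p̃` the Riesz-normalised pressure — the
DIMENSIONLESS local space–time mass of the viscous parabolic cylinder `Q^ν_ρ(T, x₀)`. In the machine paradigm's
words: around its focus a blow-up must hold an `ε` of critical space–time mass AT EVERY SCALE down to zero — not
at a sequence of scales, not above a cut-off; a cascade that empties any one parabolic shell around the focus is
regular there. Companion of the global critical floors L27–L29 (whole-space `L³`), now LOCAL and at all scales.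
HONEST SIZE NOTE: `ε` inexplicit (the CKN/RRS ε-regularity constant); qualitative in `x₀`; the pressure enters
(velocity-only versions need the gradient form of CKN at a boundary apex, not in the tree). Necessity only.
0 sorry; no new definitions, no named facts.

## References

* L. Caffarelli, R. Kohn, L. Nirenberg, Comm. Pure Appl. Math. 35 (1982) 771–831, Prop. 1. [CKN1982]
* J. C. Robinson, J. L. Rodrigo, W. Sadowski, *The Three-Dimensional Navier–Stokes Equations*, CUP 2016,
  Thm. 15.3. [RobinsonRodrigoSadowski2016]
* W. Wang, Z. Zhang, Sci. China Math. 60 (2017) 637–650, §4 Step 1. [WangZhang2016]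
* T. Tao, Anal. PDE 6 (2013) 25–107, footnote 3 (viscosity normalisation). [Tao2011]
-/

noncomputable section

open MeasureTheory Set Function Filter Topology Metric
open scoped ENNReal NNReal
open Literature.Analysis.FluidPDE Literature.Analysis.FunctionSpaces
open Summit.NavierStokesRegularity.FluidComputer.LocalisationFace

namespace Summit.NavierStokesRegularity.FluidComputer.CKNFace

/-- **The viscosity-normalised solution**: for a maximal smooth solution `(u, p)` on `[0, T)` with viscosity
`ν > 0`, Leray–Hopf from `u 0`, the fields `w = ν⁻¹ u(ν⁻¹ ·)`, `π = ν⁻² p(ν⁻¹ ·)` form a classical solution with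
viscosity `1` on `[0, νT)` (`IsClassicalNSSolutionOn.viscosityRescale_set`), Leray–Hopf from `w 0` on `[0, νT)`
(`IsLerayHopfOn.viscosityRescale`). [cite: Tao2011, footnote 3] -/
theorem rescaled_classical_lerayHopf {ν T : ℝ} (hν : 0 < ν) (hT : 0 < T)
    {u : ℝ → EuclideanSpace ℝ (Fin 3) → EuclideanSpace ℝ (Fin 3)} {p : ℝ → EuclideanSpace ℝ (Fin 3) → ℝ}
    (hcl : IsClassicalNSSolutionOn (Ico 0 T) ν 0 u p) (hLH : IsLerayHopfOn T ν 0 (u 0) u) :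
    IsClassicalNSSolutionOn (Ico 0 (T * ν)) 1 0 (timeRescale ν⁻¹ ν⁻¹ u) (timeRescale ν⁻¹ (ν⁻¹ ^ 2) p) ∧
      IsLerayHopfOn (T * ν) 1 0 (timeRescale ν⁻¹ ν⁻¹ u 0) (timeRescale ν⁻¹ ν⁻¹ u) := by
  have hν0 : ν ≠ 0 := hν.ne'
  refine ⟨?_, ?_⟩
  · have hmaps : MapsTo (fun s : ℝ => ν⁻¹ * s) (Ico 0 (T * ν)) (Ico 0 T) := by
      intro s hs
      refine ⟨mul_nonneg (inv_nonneg.2 hν.le) hs.1, ?_⟩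
      have h := mul_lt_mul_of_pos_left hs.2 (inv_pos.2 hν)
      calc ν⁻¹ * s < ν⁻¹ * (T * ν) := h
        _ = T := by field_simp
    have h := hcl.viscosityRescale_set hν0 hmaps (uniqueDiffOn_Ico 0 (T * ν))
    simpa only [timeRescale_zero_force] using h
  · have h := hLH.viscosityRescale (inv_pos.2 hν)
    have e1 : T / ν⁻¹ = T * ν := by rw [div_inv_eq_mul]
    have e2 : ν⁻¹ * ν = 1 := inv_mul_cancel₀ hν0
    have e3 : ν⁻¹ • u 0 = timeRescale ν⁻¹ ν⁻¹ u 0 := by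
      funext x
      simp [timeRescale]
    rw [e1, e2, timeRescale_zero_force, e3] at h
    exact h

/-- **L34 — THE CKN FACE: an `ε` of scale-invariant space–time mass at every scale around the singular point.**
There is an absolute `ε > 0` such that for every `ν > 0`, `T > 0` and every maximal smooth solution `(u, p)` of
the unforced Navier–Stokes system on `ℝ³ × [0, T)` which is Leray–Hopf from `u 0`, there is a point `x₀ ∈ ℝ³`
such that, for the viscosity-normalised solution `w = ν⁻¹u(ν⁻¹·)`, `π = ν⁻²p(ν⁻¹·)` (lifespan `νT`) and its
Riesz-normalised pressure gauge `q`, at EVERY scale `0 < ρ`, `ρ² < νT`: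
`ε ≤ ρ⁻² ∫∫_{Q_ρ(νT, x₀)} |w|³ + ρ⁻² ∫∫_{Q_ρ(νT, x₀)} |q|^{3/2}` (`cknC + cknD`). Proof: `x₀` is the singular point
of `LocalisationFace.exists_singularPoint`; were `C + D < ε` at some scale `ρ`, the final-time-apex ε-regularity
(`eLpNorm_top_lt_top_of_cknC_add_cknD_lt` with the proved RRS Thm. 15.3) would bound `w` essentially — hence
pointwise, by continuity — on `Q_{ρ/2}(νT, x₀)`, and so `u` on `(T − r², T) × B_r(x₀)` for
`r = ρ/(2(1 + √ν))`, contradicting singularity. [cite: CKN1982, Prop. 1]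
[cite: RobinsonRodrigoSadowski2016, Thm. 15.3] [cite: WangZhang2016, §4 Step 1] -/
theorem ckn_concentration :
    ∃ ε : ℝ, 0 < ε ∧ ∀ (ν T : ℝ), 0 < ν → 0 < T →
      ∀ (u : ℝ → EuclideanSpace ℝ (Fin 3) → EuclideanSpace ℝ (Fin 3)) (p : ℝ → EuclideanSpace ℝ (Fin 3) → ℝ),
      IsMaximalSmoothSolution ν 0 u p T → IsLerayHopfOn T ν 0 (u 0) u →
      ∃ x₀ : EuclideanSpace ℝ (Fin 3), ∀ ρ : ℝ, 0 < ρ → ρ ^ 2 < T * ν →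
        ENNReal.ofReal ε ≤
          cknC ρ ((T * ν : ℝ), x₀) (timeRescale ν⁻¹ ν⁻¹ u) +
          cknD ρ ((T * ν : ℝ), x₀) (fun s x => timeRescale ν⁻¹ (ν⁻¹ ^ 2) p s x -
            (timeRescale ν⁻¹ (ν⁻¹ ^ 2) p s 0 - normalisedPressure (timeRescale ν⁻¹ ν⁻¹ u s) 0)) := by
  obtain ⟨ε₁, cM, hε₁, -, H⟩ := RRS2016.theorem15_3_holds
  refine ⟨ε₁, hε₁, fun ν T hν hT u p hmax hLH => ?_⟩
  obtain ⟨x₀, hsing⟩ := exists_singularPoint hν hT hmax hLH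
  refine ⟨x₀, fun ρ hρ hρT => ?_⟩
  by_contra hlt
  rw [not_le] at hlt
  -- the viscosity-normalised solution `(w, π)` on `[0, νT)`
  set w : ℝ → EuclideanSpace ℝ (Fin 3) → EuclideanSpace ℝ (Fin 3) := timeRescale ν⁻¹ ν⁻¹ u with hwdef
  set π : ℝ → EuclideanSpace ℝ (Fin 3) → ℝ := timeRescale ν⁻¹ (ν⁻¹ ^ 2) p with hπdef
  have hTν : 0 < T * ν := mul_pos hT hν
  obtain ⟨hclw, hLHw⟩ := rescaled_classical_lerayHopf hν hT hmax.1 hLH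
  -- ε-regularity at the final-time apex: `w` is essentially bounded on `Q_{ρ/2}(νT, x₀)`
  have hreg := eLpNorm_top_lt_top_of_cknC_add_cknD_lt hTν hclw hLHw hε₁ H hρ hρT hlt
  set V : Set (ℝ × EuclideanSpace ℝ (Fin 3)) := parabolicCylinder (ρ / 2) ((T * ν : ℝ), x₀) with hV
  set N : ℝ := (eLpNorm (uncurry w) ∞ (volume.restrict V)).toReal with hN
  have hNtop : eLpNorm (uncurry w) ∞ (volume.restrict V) ≠ ⊤ := hreg.ne
  have hae : ∀ᵐ z ∂(volume.restrict V), ‖uncurry w z‖ ≤ N := by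
    filter_upwards [ae_le_eLpNormEssSup (f := uncurry w) (μ := volume.restrict V)] with z hz
    rw [← eLpNorm_exponent_top] at hz
    rw [← ofReal_norm] at hz
    exact (ENNReal.ofReal_le_iff_le_toReal hNtop).1 hz
  -- pointwise on the open cylinder, by continuity
  have hVo : IsOpen V := isOpen_parabolicCylinder _ _
  have hVsub : ∀ z ∈ V, ν⁻¹ * z.1 ∈ Ico 0 T := by
    intro z hz
    rw [hV, mem_parabolicCylinder] at hz
    have h1 : T * ν - (ρ / 2) ^ 2 < z.1 := hz.1.1
    have h2 : z.1 < T * ν := hz.1.2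
    have hz1 : 0 < z.1 := by nlinarith
    refine ⟨(mul_pos (inv_pos.2 hν) hz1).le, ?_⟩
    calc ν⁻¹ * z.1 < ν⁻¹ * (T * ν) := mul_lt_mul_of_pos_left h2 (inv_pos.2 hν)
      _ = T := by field_simp
  have hcont : ContinuousOn (uncurry w) V := by
    have hu := SereginSverak2002.continuousOn_uncurry hmax.1
    have hφ : Continuous (fun z : ℝ × EuclideanSpace ℝ (Fin 3) => (ν⁻¹ * z.1, z.2)) :=
      (continuous_const.mul continuous_fst).prodMk continuous_snd
    have hmaps : MapsTo (fun z : ℝ × EuclideanSpace ℝ (Fin 3) => (ν⁻¹ * z.1, z.2)) V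
        (Ico 0 T ×ˢ (univ : Set (EuclideanSpace ℝ (Fin 3)))) := fun z hz => ⟨hVsub z hz, mem_univ _⟩
    have hcomp := (hu.comp hφ.continuousOn hmaps).const_smul ν⁻¹
    refine hcomp.congr fun z _ => ?_
    simp only [hwdef, uncurry, timeRescale, Pi.smul_apply, Function.comp_apply]
  have hpt : ∀ z ∈ V, ‖uncurry w z‖ ≤ N :=
    SereginSverak2002.norm_le_of_ae_restrict_of_continuousOn hVo hcont hae
  -- the singular point of `u`: radius `r = ρ/(2(1 + √ν))`, threshold `ν N`
  set r : ℝ := ρ / (2 * (1 + Real.sqrt ν)) with hr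
  have hsq : 0 ≤ Real.sqrt ν := Real.sqrt_nonneg ν
  have hr0 : 0 < r := by rw [hr]; positivity
  have hrdef : r * (2 * (1 + Real.sqrt ν)) = ρ := by
    rw [hr]
    field_simp
  have hrρ : r ≤ ρ / 2 := by nlinarith [hrdef, mul_nonneg hr0.le hsq]
  have hνr : ν * r ^ 2 ≤ (ρ / 2) ^ 2 := by
    -- `√ν r ≤ ρ/2`
    have h1 : Real.sqrt ν * r ≤ ρ / 2 := by nlinarith [hrdef, hr0.le, hsq]
    have h2 : 0 ≤ Real.sqrt ν * r := mul_nonneg hsq hr0.le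
    calc ν * r ^ 2 = (Real.sqrt ν * r) ^ 2 := by rw [mul_pow, Real.sq_sqrt hν.le]
      _ ≤ (ρ / 2) ^ 2 := pow_le_pow_left₀ h2 h1 2
  obtain ⟨t, ht, ht0, x, hx, hbig⟩ := hsing r hr0 (ν * N)
  -- the corresponding point of the cylinder
  have hmem : ((ν * t, x) : ℝ × EuclideanSpace ℝ (Fin 3)) ∈ V := by
    rw [hV, mem_parabolicCylinder]
    refine ⟨⟨?_, ?_⟩, ?_⟩
    · show T * ν - (ρ / 2) ^ 2 < ν * t
      have h1 : T - t < r ^ 2 := by linarith [ht.1]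
      nlinarith [mul_lt_mul_of_pos_left h1 hν]
    · show ν * t < T * ν
      nlinarith [ht.2]
    · show dist x x₀ < ρ / 2
      exact (mem_ball.1 hx).trans_le hrρ
  have hle := hpt _ hmem
  -- `‖w(νt, x)‖ = ν⁻¹ ‖u(t, x)‖ > N`
  have hval : uncurry w (ν * t, x) = ν⁻¹ • u t x := by
    simp only [hwdef, uncurry, timeRescale]
    rw [← mul_assoc, inv_mul_cancel₀ hν.ne', one_mul]
  rw [hval, norm_smul, norm_inv, Real.norm_of_nonneg hν.le] at hle
  have : ‖u t x‖ ≤ ν * N := by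
    rw [inv_mul_le_iff₀ hν] at hle
    exact hle
  linarith

/-- **The CKN floor AT A GIVEN SINGULAR POINT** (the parameterised form of `ckn_concentration`, for assembly with
`LocalisationFace.exists_singularPoint`): there is an absolute `ε > 0` such that for every `ν > 0`, `T > 0`, every
classical solution `(u, p)` of the unforced Navier–Stokes system on `ℝ³ × [0, T)` which is Leray–Hopf from `u 0`,
and every point `x₀` at which `u` is unbounded on every backward parabolic neighbourhood `(T − r², T) × B_r(x₀)`:
`ε ≤ cknC ρ + cknD ρ` at `(νT, x₀)` for the viscosity-normalised solution and its Riesz pressure gauge, at EVERY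
scale `0 < ρ`, `ρ² < νT`. Maximality is not needed: the singularity of `x₀` is the hypothesis. Same proof as
`ckn_concentration`. [cite: CKN1982, Prop. 1] [cite: RobinsonRodrigoSadowski2016, Thm. 15.3]
[cite: WangZhang2016, §4 Step 1] -/
theorem ckn_concentration_at :
    ∃ ε : ℝ, 0 < ε ∧ ∀ (ν T : ℝ), 0 < ν → 0 < T →
      ∀ (u : ℝ → EuclideanSpace ℝ (Fin 3) → EuclideanSpace ℝ (Fin 3)) (p : ℝ → EuclideanSpace ℝ (Fin 3) → ℝ),
      IsClassicalNSSolutionOn (Ico 0 T) ν 0 u p → IsLerayHopfOn T ν 0 (u 0) u →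
      ∀ x₀ : EuclideanSpace ℝ (Fin 3),
        (∀ r : ℝ, 0 < r → ∀ M : ℝ, ∃ t ∈ Ioo (T - r ^ 2) T, 0 < t ∧ ∃ x ∈ ball x₀ r, M < ‖u t x‖) →
        ∀ ρ : ℝ, 0 < ρ → ρ ^ 2 < T * ν →
        ENNReal.ofReal ε ≤
          cknC ρ ((T * ν : ℝ), x₀) (timeRescale ν⁻¹ ν⁻¹ u) +
          cknD ρ ((T * ν : ℝ), x₀) (fun s x => timeRescale ν⁻¹ (ν⁻¹ ^ 2) p s x -
            (timeRescale ν⁻¹ (ν⁻¹ ^ 2) p s 0 - normalisedPressure (timeRescale ν⁻¹ ν⁻¹ u s) 0)) := by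
  obtain ⟨ε₁, cM, hε₁, -, H⟩ := RRS2016.theorem15_3_holds
  refine ⟨ε₁, hε₁, fun ν T hν hT u p hcl hLH x₀ hsing ρ hρ hρT => ?_⟩
  by_contra hlt
  rw [not_le] at hlt
  set w : ℝ → EuclideanSpace ℝ (Fin 3) → EuclideanSpace ℝ (Fin 3) := timeRescale ν⁻¹ ν⁻¹ u with hwdef
  set π : ℝ → EuclideanSpace ℝ (Fin 3) → ℝ := timeRescale ν⁻¹ (ν⁻¹ ^ 2) p with hπdef
  have hTν : 0 < T * ν := mul_pos hT hν
  obtain ⟨hclw, hLHw⟩ := rescaled_classical_lerayHopf hν hT hcl hLH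
  have hreg := eLpNorm_top_lt_top_of_cknC_add_cknD_lt hTν hclw hLHw hε₁ H hρ hρT hlt
  set V : Set (ℝ × EuclideanSpace ℝ (Fin 3)) := parabolicCylinder (ρ / 2) ((T * ν : ℝ), x₀) with hV
  set N : ℝ := (eLpNorm (uncurry w) ∞ (volume.restrict V)).toReal with hN
  have hNtop : eLpNorm (uncurry w) ∞ (volume.restrict V) ≠ ⊤ := hreg.ne
  have hae : ∀ᵐ z ∂(volume.restrict V), ‖uncurry w z‖ ≤ N := by
    filter_upwards [ae_le_eLpNormEssSup (f := uncurry w) (μ := volume.restrict V)] with z hz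
    rw [← eLpNorm_exponent_top] at hz
    rw [← ofReal_norm] at hz
    exact (ENNReal.ofReal_le_iff_le_toReal hNtop).1 hz
  have hVo : IsOpen V := isOpen_parabolicCylinder _ _
  have hVsub : ∀ z ∈ V, ν⁻¹ * z.1 ∈ Ico 0 T := by
    intro z hz
    rw [hV, mem_parabolicCylinder] at hz
    have h1 : T * ν - (ρ / 2) ^ 2 < z.1 := hz.1.1
    have h2 : z.1 < T * ν := hz.1.2
    have hz1 : 0 < z.1 := by nlinarith
    refine ⟨(mul_pos (inv_pos.2 hν) hz1).le, ?_⟩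
    calc ν⁻¹ * z.1 < ν⁻¹ * (T * ν) := mul_lt_mul_of_pos_left h2 (inv_pos.2 hν)
      _ = T := by field_simp
  have hcont : ContinuousOn (uncurry w) V := by
    have hu := SereginSverak2002.continuousOn_uncurry hcl
    have hφ : Continuous (fun z : ℝ × EuclideanSpace ℝ (Fin 3) => (ν⁻¹ * z.1, z.2)) :=
      (continuous_const.mul continuous_fst).prodMk continuous_snd
    have hmaps : MapsTo (fun z : ℝ × EuclideanSpace ℝ (Fin 3) => (ν⁻¹ * z.1, z.2)) V
        (Ico 0 T ×ˢ (univ : Set (EuclideanSpace ℝ (Fin 3)))) := fun z hz => ⟨hVsub z hz, mem_univ _⟩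
    have hcomp := (hu.comp hφ.continuousOn hmaps).const_smul ν⁻¹
    refine hcomp.congr fun z _ => ?_
    simp only [hwdef, uncurry, timeRescale, Pi.smul_apply, Function.comp_apply]
  have hpt : ∀ z ∈ V, ‖uncurry w z‖ ≤ N :=
    SereginSverak2002.norm_le_of_ae_restrict_of_continuousOn hVo hcont hae
  set r : ℝ := ρ / (2 * (1 + Real.sqrt ν)) with hr
  have hsq : 0 ≤ Real.sqrt ν := Real.sqrt_nonneg ν
  have hr0 : 0 < r := by rw [hr]; positivity
  have hrdef : r * (2 * (1 + Real.sqrt ν)) = ρ := by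
    rw [hr]
    field_simp
  have hrρ : r ≤ ρ / 2 := by nlinarith [hrdef, mul_nonneg hr0.le hsq]
  have hνr : ν * r ^ 2 ≤ (ρ / 2) ^ 2 := by
    have h1 : Real.sqrt ν * r ≤ ρ / 2 := by nlinarith [hrdef, hr0.le, hsq]
    have h2 : 0 ≤ Real.sqrt ν * r := mul_nonneg hsq hr0.le
    calc ν * r ^ 2 = (Real.sqrt ν * r) ^ 2 := by rw [mul_pow, Real.sq_sqrt hν.le]
      _ ≤ (ρ / 2) ^ 2 := pow_le_pow_left₀ h2 h1 2
  obtain ⟨t, ht, ht0, x, hx, hbig⟩ := hsing r hr0 (ν * N)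
  have hmem : ((ν * t, x) : ℝ × EuclideanSpace ℝ (Fin 3)) ∈ V := by
    rw [hV, mem_parabolicCylinder]
    refine ⟨⟨?_, ?_⟩, ?_⟩
    · show T * ν - (ρ / 2) ^ 2 < ν * t
      have h1 : T - t < r ^ 2 := by linarith [ht.1]
      nlinarith [mul_lt_mul_of_pos_left h1 hν]
    · show ν * t < T * ν
      nlinarith [ht.2]
    · show dist x x₀ < ρ / 2
      exact (mem_ball.1 hx).trans_le hrρ
  have hle := hpt _ hmem
  have hval : uncurry w (ν * t, x) = ν⁻¹ • u t x := by
    simp only [hwdef, uncurry, timeRescale]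
    rw [← mul_assoc, inv_mul_cancel₀ hν.ne', one_mul]
  rw [hval, norm_smul, norm_inv, Real.norm_of_nonneg hν.le] at hle
  have : ‖u t x‖ ≤ ν * N := by
    rw [inv_mul_le_iff₀ hν] at hle
    exact hle
  linarith

end Summit.NavierStokesRegularity.FluidComputer.CKNFace

end
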